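import Mathlib
import HarnessLib

/-!
# No honest data-driven certificate can exclude a hidden sector: two targets that agree wherever the flow proposes are
# indistinguishable from `N` proposals up to `N·q(H)`, so every certificate valid for all targets is as wide as the observable's range

HONEST FRAMING: exact (Metropolis-corrected) sampling algorithms for lattice gauge theory;
figures of merit are autocorrelation/cost numbers at stated couplings and volumes; no
continuum-physics claim.

Venture `LatticeQCDFlow` (cell pub-lqcd), topic `Exactness`; FANOUT row 30 (lean-1, GEN-41).  NEW WORK of the cell, general
measurable state space, over Mathlib only.  The certified error bars of GEN-39/40 (`IMHCoupledEstimator…`, `IMHCouplingChiSquare…`)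
take as INPUTS numbers about the weight `w = dπ/dq` that the run does not print — `c₁ = E_q[min(1, w)]`, the tails `q{w > M}`,
`π{w > M}`, or `χ²` — and one may ask whether a cleverer procedure could certify `π f` from the sampler's own data alone.  This file
proves that it cannot, by Le Cam's two-point method, in the form the topological-freezing problem takes for flow samplers.

THE DATA.  A probability space `(E, P)` (all the randomness of a session: proposals, uniforms, anything independent of the target)
and `N` proposals `Y_0, …, Y_{N−1} : E → Ω`, each with law `q` (only the marginals are used — no independence is needed).  A
PROCEDURE is any function `Φ e (v)` of the raw randomness `e` and of the vector `v = (w̃(Y_i e))_{i<N}` of (unnormalised) target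
weights AT THE PROPOSALS — this is all an importance sampler, the exact independence sampler started in the visible region (§4), the
coupled estimator and every printed diagnostic ever see of the target.  TWO WORLDS: unnormalised weights `w̃₁`, `w̃₂ : Ω → ℝ` that
AGREE on a set `V` ("the region the flow visits").

* §1 (two-point lemmas, arbitrary sets — no measurability of the procedure is needed) `measureReal_preimage_le_of_eqOn`,
  `abs_measureReal_preimage_sub_le_of_eqOn` — statistics agreeing on `G` have laws within `P(Gᶜ)` in every event;
  `measureReal_exists_not_mem_le` — `P(∃ i, Y_i ∉ V) ≤ N·q(Vᶜ)`; **`measureReal_width_lt_le_of_eqOn`** — if two interval-valued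
  statistics agree on `G` and each covers its own world's value `θ_i` up to a miss probability `α_i`, then
  `P(width₁ < |θ₁ − θ₂|) ≤ α₁ + α₂ + P(Gᶜ)`.
* §2 (procedures of the weight values at the proposals) `eqOn_proc_of_eqOn_weights`; **`proc_tv_le_of_eqOn_weights`** —
  `|P(Φ(w̃₁-data) ∈ S) − P(Φ(w̃₂-data) ∈ S)| ≤ N·q(Vᶜ)` for EVERY event `S`; **`certificate_width_lt_le_of_eqOn_weights`** —
  `P(Up − Lo < |θ₁ − θ₂| in world 1) ≤ α₁ + α₂ + N·q(Vᶜ)` for every certificate `[Lo, Up]` missing `θ_i` in world `i` w.p. `≤ α_i`.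
* §3 (THE HIDDEN SECTOR) `w̃₂ = w̃₁ + L·1_H` for a measurable `H` with `q(H) > 0`: `hiddenSector_eqOn` (agreement off `H`),
  `hiddenSector_integral` (`Z₂ = Z₁ + L·q(H)`), `hiddenSector_setIntegral`, **`hiddenSector_mass_ge`** — `π₂(H) ≥ 1 − η` once
  `L ≥ Z₁/(η·q(H))`; **`hiddenSector_no_certificate`** — for the sector weight `θ = π(H) = (∫_H w̃ dq)/(∫ w̃ dq)`: ANY procedure whose
  interval misses `π_i(H)` in world `i` with probability `≤ α_i` (`i = 1, 2`) reports in world 1, with probability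
  `≥ 1 − α₁ − α₂ − N·q(H)`, an interval of length `≥ 1 − η − π₁(H)`.  With `q(H)` far below `1/N` (a sector the flow never
  proposes) an honest certificate for `π(H)` is therefore the trivial one, `[≈0, ≈1]`, at every affordable `N` — the flow's own
  samples cannot certify that an unvisited sector is negligible, exact accept/reject step or not.
* §4 `imh_trajectory_eq_of_eqOn` — the exact sampler's run from `x ∈ V` driven by proposals in `V` and shared uniforms is THE SAME
  in both worlds (the update `x ↦ y` iff `u·w̃(x) ≤ w̃(y)` reads the weight only at the current state and the proposal), so every
  statistic of the run — acceptance rate, `ESS`-hat, the coupled estimator, its printed Bernstein bar — is a procedure in the above sense.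
* §5 `canonical_marginal_eq`, **`hiddenSector_no_certificate_iid`** — the same in the canonical model `P = q^{⊗N} ⊗ λ` (i.i.d. proposals
  and any independent auxiliary randomness).
Reading: the oracle inputs of the certified bars (a weight bound `W`, or `c₁` with the tails at a level `M`, or an upper bound on
`Z = E_q[w̃]`) are not removable: some a-priori information about the target beyond its density at the proposals, or target samples
from another exact algorithm, is NECESSARY for any non-trivial certificate; what the bars of GEN-39/40 achieve is to make that input
explicit and minimal.  Printed counterpart NAMED ONLY: Le Cam's two-point method (Le Cam 1973; Tsybakov, *Introduction to
Nonparametric Estimation*, §2.3); for flows, the "mode-collapse is invisible to model samples" remark of Nicoli et al. 2023 and the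
tree's finite-state `Scaling/Blindness.lean` (T2-L: scale-invariant statistics of the weight vector), which this file extends to
arbitrary procedures, general state spaces and certificates.  No `sorry`, no new definitions, nothing cited as a fact.
-/

noncomputable section

namespace Summit.Ventures.LatticeQCDFlow.Exactness

open MeasureTheory Set
open scoped ENNReal

/-! ## §1 Two-point lemmas (arbitrary sets) -/

section TwoPoint

variable {E : Type*} [MeasurableSpace E] {P : Measure E} [IsFiniteMeasure P]

/-- **Statistics that agree on `G` have laws within `P(Gᶜ)`**: `P(T₁ ∈ S) ≤ P(T₂ ∈ S) + P(Gᶜ)` for every set `S` (outer measure;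
nothing is assumed measurable). [folklore] -/
theorem measureReal_preimage_le_of_eqOn {Z : Type*} {T₁ T₂ : E → Z} {G : Set E} (h : EqOn T₁ T₂ G) (S : Set Z) :
    P.real (T₁ ⁻¹' S) ≤ P.real (T₂ ⁻¹' S) + P.real Gᶜ := by
  have hsub : T₁ ⁻¹' S ⊆ T₂ ⁻¹' S ∪ Gᶜ := fun e he => by
    by_cases hG : e ∈ G
    · left
      show T₂ e ∈ S
      rw [← h hG]; exact he
    · exact Or.inr hG
  exact (measureReal_mono hsub).trans (measureReal_union_le _ _)

/-- `|P(T₁ ∈ S) − P(T₂ ∈ S)| ≤ P(Gᶜ)` for statistics agreeing on `G`. [folklore] -/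
theorem abs_measureReal_preimage_sub_le_of_eqOn {Z : Type*} {T₁ T₂ : E → Z} {G : Set E} (h : EqOn T₁ T₂ G) (S : Set Z) :
    |P.real (T₁ ⁻¹' S) - P.real (T₂ ⁻¹' S)| ≤ P.real Gᶜ :=
  abs_sub_le_iff.2 ⟨by linarith [measureReal_preimage_le_of_eqOn (P := P) h S],
    by linarith [measureReal_preimage_le_of_eqOn (P := P) h.symm S]⟩

omit [IsFiniteMeasure P] in
/-- **`P(∃ i < N, Y_i ∉ V) ≤ N·q(Vᶜ)`** when each `Y_i` has law `q` (union bound; only the marginals enter). [folklore] -/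
theorem measureReal_exists_not_mem_le {Ω : Type*} [MeasurableSpace Ω] (q : Measure Ω) {N : ℕ} {Y : E → Fin N → Ω}
    (hYm : ∀ i, Measurable fun e => Y e i) (hY : ∀ i, P.map (fun e => Y e i) = q) {V : Set Ω} (hV : MeasurableSet V) :
    P.real {e | ∃ i, Y e i ∉ V} ≤ N * q.real Vᶜ := by
  have hset : {e | ∃ i, Y e i ∉ V} = ⋃ i, (fun e => Y e i) ⁻¹' Vᶜ := by
    ext e; simp only [mem_setOf_eq, mem_iUnion, mem_preimage, mem_compl_iff]
  rw [hset]
  calc P.real (⋃ i, (fun e => Y e i) ⁻¹' Vᶜ) ≤ ∑ i, P.real ((fun e => Y e i) ⁻¹' Vᶜ) := measureReal_iUnion_fintype_le _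
    _ = ∑ _i : Fin N, q.real Vᶜ := Finset.sum_congr rfl fun i _ => by
        rw [measureReal_def, measureReal_def, ← Measure.map_apply (hYm i) hV.compl, hY i]
    _ = N * q.real Vᶜ := by rw [Finset.sum_const, Finset.card_univ, Fintype.card_fin, nsmul_eq_mul]

/-- **THE TWO-POINT BOUND FOR CERTIFICATES**: two interval-valued statistics `[Lo₁, Up₁]`, `[Lo₂, Up₂]` that AGREE on `G`; if
`[Lo_i, Up_i]` misses the value `θ_i` with probability `≤ α_i` (`i = 1, 2`), then `P(Up₁ − Lo₁ < |θ₁ − θ₂|) ≤ α₁ + α₂ + P(Gᶜ)`: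
an interval honest in both worlds must contain both values, except on the miss events and where the worlds' data differ. [ours] -/
theorem measureReal_width_lt_le_of_eqOn {Lo₁ Up₁ Lo₂ Up₂ : E → ℝ} {G : Set E} (hLo : EqOn Lo₁ Lo₂ G) (hUp : EqOn Up₁ Up₂ G)
    {θ₁ θ₂ α₁ α₂ : ℝ} (hmiss₁ : P.real {e | ¬(Lo₁ e ≤ θ₁ ∧ θ₁ ≤ Up₁ e)} ≤ α₁)
    (hmiss₂ : P.real {e | ¬(Lo₂ e ≤ θ₂ ∧ θ₂ ≤ Up₂ e)} ≤ α₂) :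
    P.real {e | Up₁ e - Lo₁ e < |θ₁ - θ₂|} ≤ α₁ + α₂ + P.real Gᶜ := by
  -- both values in `[Lo₁ e, Up₁ e]` force the width to be at least `|θ₁ − θ₂|`
  have hsub : {e | Up₁ e - Lo₁ e < |θ₁ - θ₂|} ⊆
      {e | ¬(Lo₁ e ≤ θ₁ ∧ θ₁ ≤ Up₁ e)} ∪ {e | ¬(Lo₁ e ≤ θ₂ ∧ θ₂ ≤ Up₁ e)} := by
    intro e he
    simp only [mem_setOf_eq, mem_union] at he ⊢
    by_contra hcon
    push Not at hcon
    obtain ⟨⟨h1, h2⟩, ⟨h3, h4⟩⟩ := hcon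
    have : |θ₁ - θ₂| ≤ Up₁ e - Lo₁ e := abs_sub_le_iff.2 ⟨by linarith, by linarith⟩
    linarith
  -- the second event is, up to `Gᶜ`, the miss event of world 2
  have hG : {e | ¬(Lo₁ e ≤ θ₂ ∧ θ₂ ≤ Up₁ e)} ⊆ {e | ¬(Lo₂ e ≤ θ₂ ∧ θ₂ ≤ Up₂ e)} ∪ Gᶜ := by
    intro e he
    by_cases heG : e ∈ G
    · left
      simp only [mem_setOf_eq] at he ⊢
      rwa [← hLo heG, ← hUp heG]
    · exact Or.inr heG
  calc P.real {e | Up₁ e - Lo₁ e < |θ₁ - θ₂|}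
      ≤ P.real ({e | ¬(Lo₁ e ≤ θ₁ ∧ θ₁ ≤ Up₁ e)} ∪ {e | ¬(Lo₁ e ≤ θ₂ ∧ θ₂ ≤ Up₁ e)}) := measureReal_mono hsub
    _ ≤ P.real {e | ¬(Lo₁ e ≤ θ₁ ∧ θ₁ ≤ Up₁ e)} + P.real {e | ¬(Lo₁ e ≤ θ₂ ∧ θ₂ ≤ Up₁ e)} := measureReal_union_le _ _
    _ ≤ α₁ + (P.real ({e | ¬(Lo₂ e ≤ θ₂ ∧ θ₂ ≤ Up₂ e)} ∪ Gᶜ)) := add_le_add hmiss₁ (measureReal_mono hG)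
    _ ≤ α₁ + (P.real {e | ¬(Lo₂ e ≤ θ₂ ∧ θ₂ ≤ Up₂ e)} + P.real Gᶜ) := by gcongr; exact measureReal_union_le _ _
    _ ≤ α₁ + α₂ + P.real Gᶜ := by linarith

end TwoPoint

/-! ## §2 Procedures of the weight values at the proposals -/

section Procedures

variable {E : Type*} [MeasurableSpace E] {P : Measure E} [IsFiniteMeasure P]
variable {Ω : Type*} [MeasurableSpace Ω] {q : Measure Ω} {N : ℕ} {Y : E → Fin N → Ω}

omit [MeasurableSpace E] [MeasurableSpace Ω] in
/-- Two worlds whose weights agree on `V` feed THE SAME numbers to every procedure on the event that all proposals lie in `V`.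
[ours, bookkeeping] -/
theorem eqOn_proc_of_eqOn_weights {Z : Type*} (Φ : E → (Fin N → ℝ) → Z) {w₁ w₂ : Ω → ℝ} {V : Set Ω} (hw : EqOn w₁ w₂ V) :
    EqOn (fun e => Φ e fun i => w₁ (Y e i)) (fun e => Φ e fun i => w₂ (Y e i)) {e | ∀ i, Y e i ∈ V} := by
  intro e he
  simp only [mem_setOf_eq] at he
  show Φ e (fun i => w₁ (Y e i)) = Φ e (fun i => w₂ (Y e i))
  congr 1
  funext i
  exact hw (he i)

omit [MeasurableSpace E] [MeasurableSpace Ω] in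
/-- The complement of "all proposals in `V`" is "some proposal outside `V`". [ours, bookkeeping] -/
theorem compl_setOf_forall_mem (V : Set Ω) : ({e : E | ∀ i, Y e i ∈ V})ᶜ = {e | ∃ i, Y e i ∉ V} := by
  ext e; simp only [mem_compl_iff, mem_setOf_eq, not_forall]

/-- **INDISTINGUISHABILITY**: for every procedure `Φ` and every event `S`,
`|P(Φ(e, w̃₁(Y)) ∈ S) − P(Φ(e, w̃₂(Y)) ∈ S)| ≤ N·q(Vᶜ)` whenever `w̃₁ = w̃₂` on `V` and each proposal has law `q`. [ours] -/
theorem proc_tv_le_of_eqOn_weights {Z : Type*} (Φ : E → (Fin N → ℝ) → Z) {w₁ w₂ : Ω → ℝ} {V : Set Ω} (hV : MeasurableSet V)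
    (hw : EqOn w₁ w₂ V) (hYm : ∀ i, Measurable fun e => Y e i) (hY : ∀ i, P.map (fun e => Y e i) = q) (S : Set Z) :
    |P.real ((fun e => Φ e fun i => w₁ (Y e i)) ⁻¹' S) - P.real ((fun e => Φ e fun i => w₂ (Y e i)) ⁻¹' S)| ≤
      N * q.real Vᶜ := by
  refine (abs_measureReal_preimage_sub_le_of_eqOn (P := P) (eqOn_proc_of_eqOn_weights Φ hw) S).trans ?_
  rw [compl_setOf_forall_mem]
  exact measureReal_exists_not_mem_le q hYm hY hV

/-- **EVERY CERTIFICATE HONEST IN BOTH WORLDS IS AS WIDE AS THE WORLDS' DISAGREEMENT**: a certificate `[Lo, Up]` (two procedures)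
whose interval misses `θ_i` in world `i` with probability `≤ α_i`; then in world 1
`P(Up − Lo < |θ₁ − θ₂|) ≤ α₁ + α₂ + N·q(Vᶜ)`. [ours] -/
theorem certificate_width_lt_le_of_eqOn_weights (Lo Up : E → (Fin N → ℝ) → ℝ) {w₁ w₂ : Ω → ℝ} {V : Set Ω}
    (hV : MeasurableSet V) (hw : EqOn w₁ w₂ V) (hYm : ∀ i, Measurable fun e => Y e i) (hY : ∀ i, P.map (fun e => Y e i) = q)
    {θ₁ θ₂ α₁ α₂ : ℝ}
    (hmiss₁ : P.real {e | ¬(Lo e (fun i => w₁ (Y e i)) ≤ θ₁ ∧ θ₁ ≤ Up e (fun i => w₁ (Y e i)))} ≤ α₁)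
    (hmiss₂ : P.real {e | ¬(Lo e (fun i => w₂ (Y e i)) ≤ θ₂ ∧ θ₂ ≤ Up e (fun i => w₂ (Y e i)))} ≤ α₂) :
    P.real {e | Up e (fun i => w₁ (Y e i)) - Lo e (fun i => w₁ (Y e i)) < |θ₁ - θ₂|} ≤ α₁ + α₂ + N * q.real Vᶜ := by
  have h := measureReal_width_lt_le_of_eqOn (P := P) (eqOn_proc_of_eqOn_weights Lo hw) (eqOn_proc_of_eqOn_weights Up hw)
    hmiss₁ hmiss₂
  rw [compl_setOf_forall_mem] at h
  exact h.trans (by linarith [measureReal_exists_not_mem_le (P := P) q hYm hY hV])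

end Procedures

/-! ## §3 The hidden sector -/

section HiddenSector

variable {Ω : Type*} [MeasurableSpace Ω] {q : Measure Ω} [IsProbabilityMeasure q]

omit [MeasurableSpace Ω] in
/-- The hidden-sector weight `w̃₂ = w̃₁ + L·1_H` agrees with `w̃₁` off `H`. [ours, bookkeeping] -/
theorem hiddenSector_eqOn (w : Ω → ℝ) (L : ℝ) (H : Set Ω) :
    EqOn w (fun y => w y + H.indicator (fun _ => L) y) Hᶜ := fun y hy => by
  simp only [indicator_of_notMem (show y ∉ H from hy), add_zero]

/-- `Z₂ = ∫ (w̃₁ + L·1_H) dq = Z₁ + L·q(H)`. [ours, bookkeeping] -/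
theorem hiddenSector_integral {w : Ω → ℝ} (hw : Integrable w q) (L : ℝ) {H : Set Ω} (hH : MeasurableSet H) :
    ∫ y, (w y + H.indicator (fun _ => L) y) ∂q = ∫ y, w y ∂q + L * q.real H := by
  rw [integral_add hw ((integrable_const L).indicator hH), integral_indicator_const L hH, smul_eq_mul, mul_comm]

/-- `∫_H (w̃₁ + L·1_H) dq = ∫_H w̃₁ dq + L·q(H)`. [ours, bookkeeping] -/
theorem hiddenSector_setIntegral {w : Ω → ℝ} (hw : Integrable w q) (L : ℝ) {H : Set Ω} (hH : MeasurableSet H) :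
    ∫ y in H, (w y + H.indicator (fun _ => L) y) ∂q = ∫ y in H, w y ∂q + L * q.real H := by
  rw [integral_add hw.integrableOn ((integrable_const L).indicator hH).integrableOn,
    setIntegral_indicator hH, inter_self, setIntegral_const, smul_eq_mul, mul_comm]

/-- **THE HIDDEN SECTOR CARRIES ALMOST ALL OF WORLD 2**: `w̃₁ ≥ 0` with `Z₁ = ∫ w̃₁ dq > 0`, `q(H) > 0`, `η > 0`,
`L ≥ Z₁/(η·q(H))` ⇒ `π₂(H) = (∫_H w̃₂ dq)/(∫ w̃₂ dq) ≥ 1 − η`. [ours] -/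
theorem hiddenSector_mass_ge {w : Ω → ℝ} (hw : Integrable w q) (hw0 : ∀ y, 0 ≤ w y) (hZ : 0 < ∫ y, w y ∂q) {H : Set Ω}
    (hH : MeasurableSet H) (hqH : 0 < q.real H) {η : ℝ} (hη : 0 < η) {L : ℝ} (hL : (∫ y, w y ∂q) / (η * q.real H) ≤ L) :
    1 - η ≤ (∫ y in H, (w y + H.indicator (fun _ => L) y) ∂q) / ∫ y, (w y + H.indicator (fun _ => L) y) ∂q := by
  rw [hiddenSector_integral hw L hH, hiddenSector_setIntegral hw L hH]
  set Z := ∫ y, w y ∂q with hZdef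
  set I := ∫ y in H, w y ∂q with hI
  have hI0 : 0 ≤ I := setIntegral_nonneg hH fun y _ => hw0 y
  have hLpos : 0 < L := lt_of_lt_of_le (by positivity) hL
  have hLq : Z / η ≤ L * q.real H := by
    rw [div_le_iff₀ hη]
    have := (div_le_iff₀ (mul_pos hη hqH)).1 hL
    nlinarith
  have hden : 0 < Z + L * q.real H := by positivity
  rw [le_div_iff₀ hden]
  -- `(1 − η)(Z + Lq(H)) ≤ I + Lq(H)` ⟸ `Z ≤ η(Z + Lq(H))` ⟸ `Z ≤ η·L·q(H)`
  have h1 : Z ≤ η * (L * q.real H) := by rwa [div_le_iff₀' hη] at hLq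
  nlinarith [mul_nonneg hη.le hZ.le]

omit [IsProbabilityMeasure q] in
/-- `π₁(H) = (∫_H w̃₁ dq)/Z₁ ∈ [0, 1]` for `w̃₁ ≥ 0` integrable. [ours, bookkeeping] -/
theorem sectorMass_mem_Icc {w : Ω → ℝ} (hw : Integrable w q) (hw0 : ∀ y, 0 ≤ w y) (H : Set Ω) :
    (∫ y in H, w y ∂q) / (∫ y, w y ∂q) ∈ Icc (0 : ℝ) 1 := by
  have hI0 : 0 ≤ ∫ y in H, w y ∂q := integral_nonneg fun y => hw0 y
  have hZ0 : 0 ≤ ∫ y, w y ∂q := integral_nonneg fun y => hw0 y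
  have hIZ : ∫ y in H, w y ∂q ≤ ∫ y, w y ∂q := setIntegral_le_integral hw (ae_of_all _ fun y => hw0 y)
  exact ⟨div_nonneg hI0 hZ0, div_le_one_of_le₀ hIZ hZ0⟩

/-- **NO HONEST CERTIFICATE CAN EXCLUDE A HIDDEN SECTOR.**  `(E, P)` a probability space; `N` proposals `Y_i : E → Ω` each with
law `q`; `w̃₁ ≥ 0` integrable with `Z₁ = ∫ w̃₁ dq > 0` (world 1); a measurable sector `H` with `q(H) > 0`, `η > 0`,
`L ≥ Z₁/(η·q(H))` and world 2's weight `w̃₂ = w̃₁ + L·1_H` (so `π₂(H) ≥ 1 − η`); a certificate `[Lo, Up]` for the sector weight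
`π(H) = (∫_H w̃ dq)/(∫ w̃ dq)` — two arbitrary procedures of the raw randomness and of the weight values at the proposals — that
misses `π_i(H)` in world `i` with probability at most `α_i`.  THEN, in world 1,
`P(Up − Lo < 1 − η − π₁(H)) ≤ α₁ + α₂ + N·q(H)`: with `q(H) ≪ 1/N` the certificate is, with probability almost `1 − α₁ − α₂`, as long
as `1 − η − π₁(H)` — it cannot certify that the sector is light even when it is. [ours] -/
theorem hiddenSector_no_certificate {E : Type*} [MeasurableSpace E] {P : Measure E} [IsProbabilityMeasure P] {N : ℕ}
    {Y : E → Fin N → Ω} (hYm : ∀ i, Measurable fun e => Y e i) (hY : ∀ i, P.map (fun e => Y e i) = q)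
    {w : Ω → ℝ} (hw : Integrable w q) (hw0 : ∀ y, 0 ≤ w y) (hZ : 0 < ∫ y, w y ∂q) {H : Set Ω} (hH : MeasurableSet H)
    (hqH : 0 < q.real H) {η : ℝ} (hη : 0 < η) {L : ℝ} (hL : (∫ y, w y ∂q) / (η * q.real H) ≤ L)
    (Lo Up : E → (Fin N → ℝ) → ℝ) {α₁ α₂ : ℝ}
    (hmiss₁ : P.real {e | ¬(Lo e (fun i => w (Y e i)) ≤ (∫ y in H, w y ∂q) / (∫ y, w y ∂q) ∧
        (∫ y in H, w y ∂q) / (∫ y, w y ∂q) ≤ Up e (fun i => w (Y e i)))} ≤ α₁)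
    (hmiss₂ : P.real {e | ¬(Lo e (fun i => w (Y e i) + H.indicator (fun _ => L) (Y e i)) ≤
        (∫ y in H, (w y + H.indicator (fun _ => L) y) ∂q) / (∫ y, (w y + H.indicator (fun _ => L) y) ∂q) ∧
        (∫ y in H, (w y + H.indicator (fun _ => L) y) ∂q) / (∫ y, (w y + H.indicator (fun _ => L) y) ∂q) ≤
          Up e (fun i => w (Y e i) + H.indicator (fun _ => L) (Y e i)))} ≤ α₂) :
    P.real {e | Up e (fun i => w (Y e i)) - Lo e (fun i => w (Y e i)) < 1 - η - (∫ y in H, w y ∂q) / (∫ y, w y ∂q)} ≤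
      α₁ + α₂ + N * q.real H := by
  set θ₁ := (∫ y in H, w y ∂q) / (∫ y, w y ∂q) with hθ₁
  set θ₂ := (∫ y in H, (w y + H.indicator (fun _ => L) y) ∂q) / (∫ y, (w y + H.indicator (fun _ => L) y) ∂q) with hθ₂
  have hθ₂ge : 1 - η ≤ θ₂ := hiddenSector_mass_ge hw hw0 hZ hH hqH hη hL
  -- the two-world width bound with `V = Hᶜ`
  have h := certificate_width_lt_le_of_eqOn_weights (P := P) (q := q) Lo Up hH.compl (hiddenSector_eqOn w L H) hYm hY
    (θ₁ := θ₁) (θ₂ := θ₂) hmiss₁ hmiss₂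
  rw [compl_compl] at h
  refine (measureReal_mono fun e he => ?_).trans h
  simp only [mem_setOf_eq] at he ⊢
  refine lt_of_lt_of_le he ?_
  calc 1 - η - θ₁ ≤ θ₂ - θ₁ := by linarith
    _ ≤ |θ₁ - θ₂| := by rw [abs_sub_comm]; exact le_abs_self _

end HiddenSector

/-! ## §4 The exact sampler's run is such a procedure -/

/-- **THE EXACT SAMPLER RUNS IDENTICALLY IN BOTH WORLDS while it stays in `V`**: the independence-Metropolis update `x ↦ y` iff
`u·w̃(x) ≤ w̃(y)` reads the weight only at the current state and at the proposal, so from `x ∈ V`, with proposals `y_t ∈ V`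
(`t < n`) and shared uniforms, the two trajectories coincide up to time `n` (and stay in `V`).  Hence every statistic of the run is a
procedure of the raw randomness and of the weight values at the proposals, to which §2–§3 apply. [ours] -/
theorem imh_trajectory_eq_of_eqOn {Ω : Type*} {w₁ w₂ : Ω → ℝ} {V : Set Ω} (hw : EqOn w₁ w₂ V) {x : Ω} (hx : x ∈ V)
    {y : ℕ → Ω} {u : ℕ → ℝ} {n : ℕ} (hy : ∀ t, t < n → y t ∈ V) {X₁ X₂ : ℕ → Ω} (h0₁ : X₁ 0 = x) (h0₂ : X₂ 0 = x)
    (hs₁ : ∀ t, X₁ (t + 1) = if u t * w₁ (X₁ t) ≤ w₁ (y t) then y t else X₁ t)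
    (hs₂ : ∀ t, X₂ (t + 1) = if u t * w₂ (X₂ t) ≤ w₂ (y t) then y t else X₂ t) :
    ∀ t, t ≤ n → X₁ t = X₂ t ∧ X₁ t ∈ V := by
  intro t
  induction t with
  | zero => intro _; exact ⟨h0₁.trans h0₂.symm, h0₁ ▸ hx⟩
  | succ t ih =>
    intro ht
    obtain ⟨heq, hmem⟩ := ih (Nat.le_of_succ_le ht)
    have hyt : y t ∈ V := hy t (Nat.lt_of_succ_le ht)
    have hcond : (u t * w₁ (X₁ t) ≤ w₁ (y t)) ↔ (u t * w₂ (X₂ t) ≤ w₂ (y t)) := by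
      rw [hw hmem, hw hyt, heq]
    rw [hs₁ t, hs₂ t]
    by_cases hc : u t * w₁ (X₁ t) ≤ w₁ (y t)
    · rw [if_pos hc, if_pos (hcond.1 hc)]; exact ⟨rfl, hyt⟩
    · rw [if_neg hc, if_neg (fun h2 => hc (hcond.2 h2))]; exact ⟨heq, hmem⟩

/-- In particular the proposals-and-uniforms statistics of the two runs agree: any function of the trajectory up to time `n` takes
the same value in both worlds (from `x ∈ V`, proposals in `V`). [ours, bookkeeping] -/
theorem imh_runStat_eq_of_eqOn {Ω Z : Type*} {w₁ w₂ : Ω → ℝ} {V : Set Ω} (hw : EqOn w₁ w₂ V) {x : Ω} (hx : x ∈ V)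
    {y : ℕ → Ω} {u : ℕ → ℝ} {n : ℕ} (hy : ∀ t, t < n → y t ∈ V) {X₁ X₂ : ℕ → Ω} (h0₁ : X₁ 0 = x) (h0₂ : X₂ 0 = x)
    (hs₁ : ∀ t, X₁ (t + 1) = if u t * w₁ (X₁ t) ≤ w₁ (y t) then y t else X₁ t)
    (hs₂ : ∀ t, X₂ (t + 1) = if u t * w₂ (X₂ t) ≤ w₂ (y t) then y t else X₂ t)
    (F : (Fin (n + 1) → Ω) → Z) : F (fun t => X₁ t) = F (fun t => X₂ t) := by
  congr 1
  funext t
  exact (imh_trajectory_eq_of_eqOn hw hx hy h0₁ h0₂ hs₁ hs₂ t (Nat.lt_succ_iff.1 t.isLt)).1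

/-! ## §5 The canonical data model: `N` i.i.d. proposals and auxiliary randomness -/

section Canonical

variable {Ω : Type*} [MeasurableSpace Ω] {q : Measure Ω} [IsProbabilityMeasure q]
variable {U : Type*} [MeasurableSpace U] {lam : Measure U} [IsProbabilityMeasure lam]

/-- In the canonical model `E = (Fin N → Ω) × U`, `P = q^{⊗N} ⊗ λ` (i.i.d. proposals and any independent auxiliary randomness —
uniforms, seeds, …), each proposal coordinate has law `q`. [ours, bookkeeping] -/
theorem canonical_marginal_eq (N : ℕ) (i : Fin N) :
    ((Measure.pi fun _ : Fin N => q).prod lam).map (fun e : (Fin N → Ω) × U => e.1 i) = q := by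
  have h1 : (fun e : (Fin N → Ω) × U => e.1 i) = Function.eval i ∘ Prod.fst := rfl
  rw [h1, ← Measure.map_map (measurable_pi_apply i) measurable_fst, Measure.map_fst_prod, measure_univ, one_smul]
  exact (MeasureTheory.measurePreserving_eval (fun _ : Fin N => q) i).map_eq

/-- **NO HONEST CERTIFICATE CAN EXCLUDE A HIDDEN SECTOR — canonical form.**  `N` i.i.d. proposals from the flow `q` and any
independent auxiliary randomness; world 1 any non-negative integrable unnormalised weight `w̃` with `Z₁ > 0`; a measurable sector `H`
with `q(H) > 0`; `η > 0`, `L ≥ Z₁/(η·q(H))`, world 2's weight `w̃ + L·1_H`.  Every certificate `[Lo, Up]` for the sector weight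
`π(H)`, computed from the randomness and the weight values at the proposals and missing `π_i(H)` in world `i` w.p. `≤ α_i`, satisfies
`P₁(Up − Lo < 1 − η − π₁(H)) ≤ α₁ + α₂ + N·q(H)`. [ours] -/
theorem hiddenSector_no_certificate_iid (N : ℕ) {w : Ω → ℝ} (hw : Integrable w q) (hw0 : ∀ y, 0 ≤ w y) (hZ : 0 < ∫ y, w y ∂q)
    {H : Set Ω} (hH : MeasurableSet H) (hqH : 0 < q.real H) {η : ℝ} (hη : 0 < η) {L : ℝ}
    (hL : (∫ y, w y ∂q) / (η * q.real H) ≤ L) (Lo Up : (Fin N → Ω) × U → (Fin N → ℝ) → ℝ) {α₁ α₂ : ℝ}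
    (hmiss₁ : ((Measure.pi fun _ : Fin N => q).prod lam).real {e | ¬(Lo e (fun i => w (e.1 i)) ≤
        (∫ y in H, w y ∂q) / (∫ y, w y ∂q) ∧ (∫ y in H, w y ∂q) / (∫ y, w y ∂q) ≤ Up e (fun i => w (e.1 i)))} ≤ α₁)
    (hmiss₂ : ((Measure.pi fun _ : Fin N => q).prod lam).real {e | ¬(Lo e (fun i => w (e.1 i) + H.indicator (fun _ => L) (e.1 i)) ≤
        (∫ y in H, (w y + H.indicator (fun _ => L) y) ∂q) / (∫ y, (w y + H.indicator (fun _ => L) y) ∂q) ∧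
        (∫ y in H, (w y + H.indicator (fun _ => L) y) ∂q) / (∫ y, (w y + H.indicator (fun _ => L) y) ∂q) ≤
          Up e (fun i => w (e.1 i) + H.indicator (fun _ => L) (e.1 i)))} ≤ α₂) :
    ((Measure.pi fun _ : Fin N => q).prod lam).real {e | Up e (fun i => w (e.1 i)) - Lo e (fun i => w (e.1 i)) <
        1 - η - (∫ y in H, w y ∂q) / (∫ y, w y ∂q)} ≤ α₁ + α₂ + N * q.real H :=
  hiddenSector_no_certificate (P := (Measure.pi fun _ : Fin N => q).prod lam) (Y := fun e => e.1)
    (fun i => (measurable_pi_apply i).comp measurable_fst) (canonical_marginal_eq N) hw hw0 hZ hH hqH hη hL Lo Up hmiss₁ hmiss₂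

end Canonical

end Summit.Ventures.LatticeQCDFlow.Exactness
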